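import Summits.SmoothPoincare4.SmoothPoincare4.Theses.IsotropicCorkBracketing
import Literature.Geometry.Riemannian.ChenZhuConformalPic
import Literature.Geometry.Riemannian.ChenZhuConformalPicProofs

/-!
# Route `IsotropicCorkBracketing`, item `ConformalPic` (stmt-SmoothPoincare4-9827)

Chen–Zhu 2014, Cor. 2.2 with §3 ¶1 (= Gursky–LeBrun 1998, Prop. 3): on a closed smooth
4-manifold a Riemannian metric whose isotropic Yamabe form `∫ (6|∇u|² + 3μu²) dV` dominates
`c ∫ u² dV` (`c > 0`, `μ` a continuous lower bound of the isotropic curvatures) admits — in its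
conformal class — a metric of positive isotropic curvature.

The tree holds this as the named fact
`Literature.Geometry.Riemannian.chenZhu_conformalPic_of_isotropicFormPos` (conformal form, with
the factor `u²`), DISCHARGED in `ChenZhuConformalPicProofs.lean`
(`chenZhu_conformalPic_of_isotropicFormPos_holds`: positive smooth strict supersolution of the
coercive operator `−Δ + μ/2`, conformal law of the frame-wise isotropic curvature), and its
route-shaped corollary `chenZhu_pic_of_isotropicFormPos` (forget the conformal factor). The item
is literally that corollary applied to the discharge.
-/

-- the prescribed namespace `Summit.<P>.<Sub>.…` duplicates `SmoothPoincare4` (P = Sub)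
set_option linter.dupNamespace false

namespace Summit.SmoothPoincare4.SmoothPoincare4.Theorems

open Summit.SmoothPoincare4.SmoothPoincare4.Theses.IsotropicCorkBracketing

/-- **Item `ConformalPic` of route `IsotropicCorkBracketing` holds** (Chen–Zhu 2014, Cor. 2.2 and
§3 ¶1; Gursky–LeBrun 1998, Prop. 3): a positive definite isotropic Yamabe form on a closed smooth
4-manifold yields a Riemannian metric of positive isotropic curvature. Proof: the route decl is
verbatim the conclusion of `Literature.Geometry.Riemannian.chenZhu_pic_of_isotropicFormPos`, whose
hypothesis `chenZhu_conformalPic_of_isotropicFormPos` is proved in the tree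
(`chenZhu_conformalPic_of_isotropicFormPos_holds`). -/
theorem conformalPic_proof : ConformalPic := by
  unfold ConformalPic
  exact Literature.Geometry.Riemannian.chenZhu_pic_of_isotropicFormPos
    Literature.Geometry.Riemannian.chenZhu_conformalPic_of_isotropicFormPos_holds

end Summit.SmoothPoincare4.SmoothPoincare4.Theorems
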